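import Literature.MathematicalPhysics.QuantumManyBody.NeumannSymmetrization
import Literature.MathematicalPhysics.QuantumManyBody.FourierBoundCompactSupport
import HarnessLib

/-!
# Properties of the mirror images and of the symmetrisation (FGJMOT Lemma 5.1)

Topic `Literature/MathematicalPhysics/QuantumManyBody`, namespace `NeumannBox` (provefact
`Literature.MathematicalPhysics.QuantumManyBody.BoseGas.Junge2026_neumannBox_pinnedLowerBound`; brick 20,
companion of `NeumannSymmetrization.lean` / `NeumannSymmetrizationSeries.lean`). [FournaisEtAl2024,
Lemma 5.1] lists four properties of the mirror maps `p_z` (2.19) and of `f^s` (2.21) for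
`x, y ∈ Λ`, `f` radial with `supp f ⊆ B(0,R)`, `R ≤ ℓ/2`:
(1) `f(p_z(x) - y) = 0` if some `|zᵢ| ≥ 2` (`apply_mirror_sub_eq_zero`, Series file);
(2) `f^s(x,y) = f^s(y,x)`; (3) `|p_z(x) - y| ≥ |x - y|`; (4) `u_p ∘ p_z = u_p` (`mode_mirror`).
Here we prove (2) and (3), in the sharper forms the proof actually gives:

* `mirror₁_of_even`, `mirror₁_of_odd` — `p_z(t) = t + ℓz` (`z` even), `= ℓ(z+1) - t` (`z` odd);
* `abs_mirror₁_sub_comm`, `norm_mirror_sub_comm` — `|p_z(x) - y| = |p_z(y) - x|` for `z ∈ {-1,0,1}³`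
  and all `x, y ∈ ℝ³`;
* `FournaisEtAl2024_lemma51_symm` — (2): `symmetrize ℓ f x y = symmetrize ℓ f y x` for radial `f`
  (all `x, y`; no support hypothesis is needed for the sum over `{-1,0,1}³`);
* `abs_sub_le_abs_mirror₁_sub`, `FournaisEtAl2024_lemma51_dist` — (3): `|x - y| ≤ |p_z(x) - y|` for
  `x, y ∈ [0,ℓ]³` and every `z ∈ ℤ³`;
* `integral_apply_mirror_sub`, `setIntegral_cell_apply_mirror_sub_le` — the translation step of the
  symmetrisation estimates (5.1)–(5.2): `∫_{ℝ³} g(p_z(x) - y) dy = ∫ g` and, for `g ≥ 0`,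
  `∫_Λ g(p_z(x) - y) dy ≤ ∫ g`; `boundaryLayer_volume_le` — `|Λ ∖ Λ_R| = ℓ³ - (ℓ-2R)³ ≤ 6Rℓ²`
  (the arithmetic of "`|Λ ∖ Λ_R| ≤ CRℓ²`").

No definitions.

## References

* [FournaisEtAl2024] S. Fournais et al., arXiv:2408.14222, Ann. Henri Poincaré (2026): Lemma 5.1
  and its proof; (5.1)–(5.2).
-/

noncomputable section

open Real MeasureTheory Set Finset
open scoped BigOperators

namespace Literature.MathematicalPhysics.QuantumManyBody.NeumannBox

open Literature.MathematicalPhysics.QuantumManyBody.BoseGas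

variable {ℓ : ℝ}

/-! ### The one-dimensional mirror by parity -/

/-- For even `z`, `p_z(t) = t + ℓz`. [cite: FournaisEtAl2024, (2.19)] -/
theorem mirror₁_of_even {z : ℤ} (hz : Even z) (ℓ t : ℝ) : mirror₁ ℓ z t = t + ℓ * z := by
  unfold mirror₁
  rw [hz.neg_one_zpow]
  ring

/-- For odd `z`, `p_z(t) = ℓ(z + 1) - t`. [cite: FournaisEtAl2024, (2.19)] -/
theorem mirror₁_of_odd {z : ℤ} (hz : Odd z) (ℓ t : ℝ) : mirror₁ ℓ z t = ℓ * (z + 1) - t := by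
  unfold mirror₁
  rw [hz.neg_one_zpow]
  ring

/-! ### Property (2): symmetry of `f^s` -/

/-- `|p_z(t) - s| = |p_z(s) - t|` for `z ∈ {-1, 0, 1}`. [cite: FournaisEtAl2024, Lemma 5.1 (proof of (2))] -/
theorem abs_mirror₁_sub_comm {z : ℤ} (hz : z ∈ Finset.Icc (-1 : ℤ) 1) (ℓ t s : ℝ) :
    |mirror₁ ℓ z t - s| = |mirror₁ ℓ z s - t| := by
  rw [Finset.mem_Icc] at hz
  obtain ⟨h1, h2⟩ := hz
  interval_cases z
  · rw [mirror₁_neg_one, mirror₁_neg_one, show -t - s = -s - t by ring]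
  · rw [mirror₁_zero, mirror₁_zero, abs_sub_comm]
  · rw [mirror₁_one, mirror₁_one, show 2 * ℓ - t - s = 2 * ℓ - s - t by ring]

/-- `|p_z(x) - y| = |p_z(y) - x|` for `z ∈ {-1,0,1}³` and all `x, y ∈ ℝ³`.
[cite: FournaisEtAl2024, Lemma 5.1 (proof of (2))] -/
theorem norm_mirror_sub_comm {z : Fin 3 → ℤ} (hz : z ∈ nearImages) (x y : Space) :
    ‖mirror ℓ z x - y‖ = ‖mirror ℓ z y - x‖ := by
  have hzi : ∀ i, z i ∈ Finset.Icc (-1 : ℤ) 1 := Fintype.mem_piFinset.1 hz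
  simp only [EuclideanSpace.norm_eq]
  congr 1
  refine Finset.sum_congr rfl fun i _ => ?_
  rw [Real.norm_eq_abs, Real.norm_eq_abs, PiLp.sub_apply, PiLp.sub_apply, mirror_apply, mirror_apply,
    abs_mirror₁_sub_comm (hzi i)]

/-- **FGJMOT Lemma 5.1 (2): the symmetrisation of a radial function is symmetric**,
`f^s(x,y) = f^s(y,x)`. [cite: FournaisEtAl2024, Lemma 5.1 (2)] -/
theorem FournaisEtAl2024_lemma51_symm {f : Space → ℝ} (hrad : ∀ x y : Space, ‖x‖ = ‖y‖ → f x = f y)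
    (x y : Space) : symmetrize ℓ f x y = symmetrize ℓ f y x :=
  Finset.sum_congr rfl fun _ hz => hrad _ _ (norm_mirror_sub_comm hz x y)

/-! ### Property (3): the images are farther away -/

/-- `|t - s| ≤ |p_z(t) - s|` for `t, s ∈ [0, ℓ]` and every `z ∈ ℤ`. [cite: FournaisEtAl2024, Lemma 5.1 (3)] -/
theorem abs_sub_le_abs_mirror₁_sub (z : ℤ) {t s : ℝ} (ht : t ∈ Icc 0 ℓ) (hs : s ∈ Icc 0 ℓ) :
    |t - s| ≤ |mirror₁ ℓ z t - s| := by
  obtain ⟨ht0, ht1⟩ := ht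
  obtain ⟨hs0, hs1⟩ := hs
  have hℓ0 : 0 ≤ ℓ := ht0.trans ht1
  have hts : |t - s| ≤ ℓ := by rw [abs_le]; constructor <;> linarith
  rcases Int.even_or_odd z with he | ho
  · rw [mirror₁_of_even he]
    obtain ⟨m, hm⟩ := he
    have hcases : z = 0 ∨ z ≤ -2 ∨ 2 ≤ z := by omega
    rcases hcases with rfl | hz | hz
    · simp
    · have hz' : (z : ℝ) ≤ -2 := by exact_mod_cast hz
      have hprod := mul_le_mul_of_nonneg_left hz' hℓ0
      refine hts.trans ?_
      rw [abs_of_nonpos (by linarith)]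
      linarith
    · have hz' : (2 : ℝ) ≤ z := by exact_mod_cast hz
      have hprod := mul_le_mul_of_nonneg_left hz' hℓ0
      refine hts.trans ?_
      rw [abs_of_nonneg (by linarith)]
      linarith
  · rw [mirror₁_of_odd ho]
    obtain ⟨m, hm⟩ := ho
    have hcases : z = -1 ∨ z = 1 ∨ z ≤ -3 ∨ 3 ≤ z := by omega
    rcases hcases with rfl | rfl | hz | hz
    · push_cast
      rw [show ℓ * (-1 + 1) - t - s = -(t + s) by ring, abs_neg]
      exact abs_le_abs (by linarith) (by linarith)
    · push_cast
      rw [show ℓ * (1 + 1) - t - s = (ℓ - t) + (ℓ - s) by ring]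
      exact abs_le_abs (by linarith) (by linarith)
    · have hz' : (z : ℝ) + 1 ≤ -2 := by
        have : ((z + 1 : ℤ) : ℝ) ≤ -2 := by exact_mod_cast (by omega : z + 1 ≤ -2)
        push_cast at this; exact this
      have hprod := mul_le_mul_of_nonneg_left hz' hℓ0
      refine hts.trans ?_
      rw [abs_of_nonpos (by linarith)]
      linarith
    · have hz' : (4 : ℝ) ≤ z + 1 := by
        have : (4 : ℝ) ≤ ((z + 1 : ℤ) : ℝ) := by exact_mod_cast (by omega : 4 ≤ z + 1)
        push_cast at this; exact this
      have hprod := mul_le_mul_of_nonneg_left hz' hℓ0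
      refine hts.trans ?_
      rw [abs_of_nonneg (by linarith)]
      linarith

/-- **FGJMOT Lemma 5.1 (3): `|p_z(x) - y| ≥ |x - y|`** for `x, y ∈ Λ = [0,ℓ]³` and every `z ∈ ℤ³`.
[cite: FournaisEtAl2024, Lemma 5.1 (3)] -/
theorem FournaisEtAl2024_lemma51_dist (z : Fin 3 → ℤ) {x y : Space} (hx : ∀ i, x i ∈ Icc 0 ℓ)
    (hy : ∀ i, y i ∈ Icc 0 ℓ) : ‖x - y‖ ≤ ‖mirror ℓ z x - y‖ := by
  simp only [EuclideanSpace.norm_eq]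
  refine Real.sqrt_le_sqrt (Finset.sum_le_sum fun i _ => ?_)
  rw [Real.norm_eq_abs, Real.norm_eq_abs, PiLp.sub_apply, PiLp.sub_apply, mirror_apply]
  exact pow_le_pow_left₀ (abs_nonneg _) (abs_sub_le_abs_mirror₁_sub (z i) (hx i) (hy i)) 2

/-! ### The translation step and the boundary layer of (5.1)–(5.2) -/

/-- `∫_{ℝ³} g(p_z(x) - y) dy = ∫ g` (translation and reflection invariance).
[cite: FournaisEtAl2024, (5.1) (proof)] -/
theorem integral_apply_mirror_sub (g : Space → ℝ) (z : Fin 3 → ℤ) (x : Space) :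
    ∫ y : Space, g (mirror ℓ z x - y) = ∫ w, g w := by
  have h1 : ∀ y : Space, g (mirror ℓ z x - y) = (fun w => g (-w)) (-mirror ℓ z x + y) := by
    intro y; simp only [neg_add_rev, neg_neg]; rw [← sub_eq_neg_add]
  simp_rw [h1]
  rw [integral_add_left_eq_self (fun w => g (-w)) (-mirror ℓ z x)]
  exact integral_comp_neg_space g

/-- For `g ≥ 0` integrable, `∫_Λ g(p_z(x) - y) dy ≤ ∫_{ℝ³} g`. [cite: FournaisEtAl2024, (5.1) (proof)] -/
theorem setIntegral_cell_apply_mirror_sub_le {g : Space → ℝ} (hg : ∀ w, 0 ≤ g w) (hgi : Integrable g)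
    (z : Fin 3 → ℤ) (x : Space) :
    ∫ y in cell ℓ, g (mirror ℓ z x - y) ≤ ∫ w, g w := by
  have hint : Integrable fun y : Space => g (mirror ℓ z x - y) := by
    have h1 : (fun y : Space => g (mirror ℓ z x - y)) = (fun w => g (-w)) ∘ (fun y => -mirror ℓ z x + y) := by
      ext y; simp only [Function.comp, neg_add_rev, neg_neg]; rw [← sub_eq_neg_add]
    rw [h1]
    exact (hgi.comp_neg).comp_add_left _
  rw [← integral_apply_mirror_sub g z x]
  exact setIntegral_le_integral hint (Filter.Eventually.of_forall fun y => hg _)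

/-- **The boundary layer `Λ ∖ Λ_R`, `Λ_R = [R, ℓ-R]³`, has volume `ℓ³ - (ℓ-2R)³ ≤ 6Rℓ²`**
(`0 ≤ R ≤ ℓ/2`). [cite: FournaisEtAl2024, (5.1) ("|Λ ∖ Λ_R| ≤ CRℓ²")] -/
theorem boundaryLayer_volume_le {R : ℝ} (hR : 0 ≤ R) (hRℓ : 2 * R ≤ ℓ) :
    ℓ ^ 3 - (ℓ - 2 * R) ^ 3 ≤ 6 * R * ℓ ^ 2 := by
  nlinarith [mul_nonneg hR (mul_nonneg hR (by linarith : (0 : ℝ) ≤ ℓ - 2 * R)),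
    mul_nonneg hR (mul_nonneg hR hR)]

end Literature.MathematicalPhysics.QuantumManyBody.NeumannBox
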